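import Summits.QuantumFields.YangMills.Theorems.BalabanUVNodesN09RegularityTowerOfChartRegularity
import Summits.QuantumFields.YangMills.Theorems.BalabanUVNodesN09GaugeFixingTermContinuousOnAdmissible
import Summits.QuantumFields.YangMills.Theorems.BalabanUVNodesN09LiftInvariance29AtRecord

/-!
# NODE N09 · THE (F1) TOWER ON PURELY GEOMETRIC CHART DATA: the two non-chart per-step inputs of the tower run — `hmeas` (a.e.-strong measurability of the fibre integrand,
# which mentions `ρ_k`) and `hGF` (continuity of the gauge-fixing term on `domAlt_k`) — are THEOREMS (of the confinement, of the recursion's own `A_k`, and of the numerics)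

Cell `pub-ymgap` (YM-PLAN Track A), DAG node N09 [Balaban1987RG1] (= [I]); seat `pub-ymgap-dag-n09-w1` g5 (D-0149 width seat 1 of node N09), FILE 5; count-neutral K1-face
helper keyed to K1⁸ `StabilityBRunRowsAtRecordR13SepCoPH` = stmt-QuantumFields-26907 (`--kind proof --supports … --as helper`; dag-lead GATE v1.65 KEY MAP).  HONEST FRAMING:
kernel measure theory ∕ topology BY NAME over FILES 2–4; NOTHING of Bałaban's analysis asserted; every chart datum DISPLAYED ((M3r) stays UNOWNED); N09 NOT discharged;
K0⁷∕K1⁸ NOT closed; counts unmoved (typed 28∕28 · discharged 5∕27); one finite 𝕋⁴ programme at fixed ε — R4 closes the conditional rung `BalabanLadder.UV` only; the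
Yang–Mills mass gap (Clay) is NOT proved by any of this; nothing continuum ∕ ℝ⁴ ∕ OS.

WHY.  FILE 3 (`…N09RegularityTowerOfChartRegularity`) ran the (F1) induction from per-step chart data `hΦ hJ havgΦ hmap hconf hΦV hJV hφ hnull hz₀ hΦc hJpos` PLUS two
inputs that are not chart geometry: `hmeas` — a.e.-strong measurability of `z ↦ J(V,z)·ρ_k(Φ(V,z))`, which MENTIONS `ρ_k` (hence the recursion, through `A_k`) — and `hGF`
— continuity of `GF_k` on `domAlt_k`.  FILE 4 proved `hGF` from the numerics `((d·L)²∕4)·ν.ε₀ < δ_N`.  THIS FILE proves `hmeas` from the chart's CONFINEMENT and the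
tower's OWN `A_k`: along a measurable chart with `Ū(Φ(V,z)) = V` the (2.9) cut-off `χ^{(2.9)}_k(Φ(V,z))` is a measurable function of `z` (its deviations read against the
FIXED critical configuration `V^{(k)}(V)`: `dist1(V^{(k)}(V)(b)⁻¹·Φ(V,z)(b))`, measurable in `z` — no (H-U) measurable selection of minimisers needed), and the smooth factor
`exp[−GF_k∕g_k² + A_k](Φ(V,z))` agrees `τ`-a.e. with a measurable surrogate because `Φ(V,z)` stays (a.e.) in `domAlt_k`, where `GF_k` and `A_k` are CONTINUOUS (so their
measurable piecewise extensions by `0` compose measurably).  Then the tower is re-run with `hmeas := …` (from `ih : ContinuousOn A_j domAlt_j`) and `hGF := FILE 4`: the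
per-step data of N09's analytic inclusion `hreg` are now EXACTLY the geometry + standard analysis of [I]'s (2.10) chart, plus [B11] `hsolν`, (I19) `hint`, and numerics.

WHAT IS PROVED (theorems only; 0 def; 0 sorry; axioms standard).
* §1 `measurable_chiFix29OfRecord_comp_chart` (the cut-off along a measurable chart over `V` is measurable in the fibre coordinate — unconditionally),
  ★★ `aestronglyMeasurable_fibreIntegrand_of_confined` (`hmeas` at one `V` ⇐ `Φ`, `J` measurable, `Ū∘Φ(V,·) = V`, `Φ(V,·) ∈ D` a.e., `GF_k`, `A_k` continuous on the
  measurable set `D`), ★★ `hmeas_of_confined` (the doors' `∀ V₀ ∈ U, ∀ᶠ V in 𝓝[U] V₀, …` shape from FILE 2's `hconf`).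
* §2 (standing range: dag-n09-w2's `N09LiftInvariance29AtRecord.succ_le_range_of_lt` BY NAME) ★★★ `continuousOn_effActionHT_all_of_geometricChartData` (THE TOWER re-run: `∀ j ≤ K, ContinuousOn A_j domAlt_j` from GEOMETRIC
  per-step data + `hcrit` (N07: `V^{(j)}` continuous on `domAlt_{j+1}`) + `hsolν` + `hint` + `0 < ε₁`, `0 ≤ ν.ε₀`, `((d·L)²∕4)·ν.ε₀ < δ_N`), ★★★ `hreg_pos_all_of_geometricChartData`.
* §3 AT THE STAGE-13 RECORD: ★★ `hreg_of_geometricChartData`, ★★★ `thm3Member_stage13SepCoPH_atDomAlt_of_geometricChartData_of_numerics_of_εreg_eq` (dag-n09-w4 g3's door with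
  `hreg` replaced by GEOMETRIC per-step chart data and ONE more numerics letter).

HONEST SCOPE.  The chart, its base point and its A-free regularity (`hΦV hJV hnull hconf`), `hcrit` (N07's [B11] Thm 1 for a continuous selector — at the bare-choice `Uk` it
is a convention, as dag-n09-w2's (181) `hcov`), `hsolν`, `hint`, `hcov`, [B11] ×3 and the numerics stay DISPLAYED; nothing of FILES 1–4 ∕ w4 ∕ w6 ∕ K0e re-proved.
-/

noncomputable section

open MeasureTheory Set Filter Topology
open scoped ENNReal NNReal
open Literature.MathematicalPhysics.QuantumFieldTheory
open Literature.MathematicalPhysics.QuantumFieldTheory.Balaban1983to89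
open Literature.MathematicalPhysics.QuantumFieldTheory.Balaban1983to89.Node00
open Literature.MathematicalPhysics.QuantumFieldTheory.Balaban1983to89.T4Continuum (T4Family)
open Literature.MathematicalPhysics.QuantumFieldTheory.Balaban1983to89.DagBinding (WorldP leavesP)
open Literature.MathematicalPhysics.QuantumFieldTheory.Balaban1983to89.B12RTGaugeInvariance254 (liftTransf)
open Literature.MathematicalPhysics.QuantumFieldTheory.Balaban1983to89.GaugeField (gaugeAct)
open Literature.MathematicalPhysics.QuantumFieldTheory.Balaban1983to89.ExpMeanLog (deltaSU)
open Literature.MathematicalPhysics.QuantumFieldTheory.Balaban1983to89.FederbushMean (deltaFed)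
open Literature.MathematicalPhysics.QuantumFieldTheory.Balaban1983to89.B12ContinuousTransportInvarianceOn (continuous_dist1_SU)
open Literature.MathematicalPhysics.QuantumFieldTheory.Balaban1983to89.B12NodeKnitContinuousTransport (measurable_gfOfRecord)
open Summit.QuantumFields.YangMills.BalabanUVNodes.N09TransportPositiveOnDomainOfFibredChart (betaInput_chi29_apply fluctDevOfRecord_eq_of_avg_eq)
open Summit.QuantumFields.YangMills.BalabanUVNodes.N09FibreIntegralContinuousOfChartRegularity
open Summit.QuantumFields.YangMills.BalabanUVNodes.N09RegularityTowerOfChartRegularity (hreg_pos_all_of_chartRegularity)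
open Summit.QuantumFields.YangMills.BalabanUVNodes.N09HregOfFibredChartAtRecord (mem_setOf_chi_ne_zero_of_betaInputOfRecord_ne_zero)
open Summit.QuantumFields.YangMills.BalabanUVNodes.N09B0RiderAtRecord (thm3Member_stage13SepCoPH_atDomAlt_of_numerics_of_εreg_eq)
open Summit.QuantumFields.YangMills.BalabanUVNodes.N09GaugeFixingTermContinuousOnAdmissible (continuousOn_gfOfRecord_domAlt)
open Summit.QuantumFields.YangMills.BalabanUVNodes.N09LiftInvariance29AtRecord (succ_le_range_of_lt)

namespace Summit.QuantumFields.YangMills.BalabanUVNodes.N09RegularityTowerOfGeometricChartData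

variable {F : T4Family} {N : ℕ} [NeZero N]

/-! ## §1 `hmeas` from confinement: the fibre integrand is a.e.-strongly measurable along a measurable chart confined in `domAlt_k` -/

section Hmeas

variable {Z : Type*} [MeasurableSpace Z]

/-- **THE (2.9) CUT-OFF ALONG A MEASURABLE CHART OVER `V` IS MEASURABLE IN THE FIBRE COORDINATE** — unconditionally: its deviations read against the FIXED reference
`V^{(k)}(V)` (`Ū(Φ(V,z)) = V`), `z ↦ dist1(V^{(k)}(V)(b)⁻¹·Φ(V,z)(b))` is measurable, and `χ^{(2.9)}` is the indicator of finitely many strict inequalities.  (No measurable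
selection of minimisers is needed along a fibre.) [cite: Balaban1987RG1, (2.9) p.266 (bookkeeping)] -/
theorem measurable_chiFix29OfRecord_comp_chart (ν : Stage7Numerics) (ε₁ : ℝ) {K k : ℕ}
    {Φ : (PBond (F.P K) (k + 1) → SU N) × Z → GaugeField (F.P K) k (SU N)} (hΦ : Measurable Φ)
    {V : PBond (F.P K) (k + 1) → SU N} (havgΦ : ∀ z, (avOfRecord F N K k).avg (Φ (V, z)) = V) :
    Measurable fun z => chiFix29OfRecord F N ν ε₁ K k (Φ (V, z)) := by
  have hΦV : Measurable fun z => Φ (V, z) := hΦ.comp measurable_prodMk_left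
  set S : Set Z := {z | ∀ b : PBond (F.P K) k, ¬ IsB0 b → dist1 ((critCfgOfRecord F N ν K k V b)⁻¹ * Φ (V, z) b) < ε₁} with hS_def
  have hSb : ∀ b : PBond (F.P K) k, MeasurableSet {z | ¬ IsB0 b → dist1 ((critCfgOfRecord F N ν K k V b)⁻¹ * Φ (V, z) b) < ε₁} := by
    intro b
    by_cases hb : IsB0 b
    · have : {z : Z | ¬ IsB0 b → dist1 ((critCfgOfRecord F N ν K k V b)⁻¹ * Φ (V, z) b) < ε₁} = univ :=
        Set.eq_univ_of_forall fun z h => absurd hb h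
      rw [this]; exact MeasurableSet.univ
    · have : {z : Z | ¬ IsB0 b → dist1 ((critCfgOfRecord F N ν K k V b)⁻¹ * Φ (V, z) b) < ε₁} =
          {z | dist1 ((critCfgOfRecord F N ν K k V b)⁻¹ * Φ (V, z) b) < ε₁} := by
        ext z; simp [hb]
      rw [this]
      exact measurableSet_lt (RegularGaugeGroup.measurable_dist1.comp (measurable_const.mul ((measurable_pi_apply b).comp hΦV)))
        measurable_const
  have hS : MeasurableSet S := by
    rw [hS_def, Set.setOf_forall]
    exact MeasurableSet.iInter hSb
  have e : (fun z => chiFix29OfRecord F N ν ε₁ K k (Φ (V, z))) = S.indicator fun _ => (1 : ℝ) := by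
    funext z
    by_cases hz : z ∈ S
    · rw [Set.indicator_of_mem hz]
      exact (chiFix29OfRecord_eq_one_iff ν ε₁ K k _).2 fun b hb => by
        rw [fluctDevOfRecord_eq_of_avg_eq ν (havgΦ z) b]; exact hz b hb
    · rw [Set.indicator_of_notMem hz]
      rcases chiFix29OfRecord_eq_zero_or_one ν ε₁ K k (Φ (V, z)) with h | h
      · exact h
      · exact absurd ((chiFix29OfRecord_eq_one_iff ν ε₁ K k _).1 h) fun h' => hz fun b hb => by
          rw [← fluctDevOfRecord_eq_of_avg_eq ν (havgΦ z) b]; exact h' b hb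
  rw [e]
  exact measurable_const.indicator hS

/-- **★★ `hmeas` AT ONE COARSE FIELD FROM CONFINEMENT**: along a measurable chart `Φ` with measurable Jacobian `J` over `V` (`Ū(Φ(V,z)) = V`) whose fibre points lie
`τ`-a.e. in a measurable set `D` of step-`k` fields on which `GF_k` and `A_k` are continuous, the fibre integrand `z ↦ J(V,z)·ρ_k(Φ(V,z))` of the β-input
`ρ_k = χ^{(2.9)}_k·exp[−GF_k∕g_k² + A_k]` is a.e.-strongly measurable for `τ` (measurable surrogate: `GF_k`, `A_k` extended by `0` off `D`, `ContinuousOn.measurable_piecewise`).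
[cite: Balaban1987RG1, (0.19) p.255 and (2.10) p.267 (bookkeeping)] -/
theorem aestronglyMeasurable_fibreIntegrand_of_confined (ν : Stage7Numerics) (ε₁ : ℝ) (T : Transport F N) (K : ℕ) (g : ℕ → ℝ) (k : ℕ)
    {τ : Measure Z} {Φ : (PBond (F.P K) (k + 1) → SU N) × Z → GaugeField (F.P K) k (SU N)} {J : (PBond (F.P K) (k + 1) → SU N) × Z → ℝ≥0}
    (hΦ : Measurable Φ) (hJ : Measurable J) {D : Set (GaugeField (F.P K) k (SU N))} (hDm : MeasurableSet D)
    (hGF : ContinuousOn (gfOfRecord F N K k) D) (hA : ContinuousOn (effActionHT F N T (chiFixed29 F N ν ε₁) K g k) D)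
    {V : PBond (F.P K) (k + 1) → SU N} (havgΦ : ∀ z, (avOfRecord F N K k).avg (Φ (V, z)) = V) (hdom : ∀ᵐ z ∂τ, Φ (V, z) ∈ D) :
    AEStronglyMeasurable (fun z => (J (V, z) : ℝ) * betaInputOfRecord F N T (chiFixed29 F N ν ε₁) K g k (Φ (V, z))) τ := by
  classical
  haveI : OpensMeasurableSpace (GaugeField (F.P K) k (SU N)) := inferInstanceAs (OpensMeasurableSpace (PBond (F.P K) k → SU N))
  have hΦV : Measurable fun z => Φ (V, z) := hΦ.comp measurable_prodMk_left
  have hJV : Measurable fun z => (J (V, z) : ℝ) := (hJ.comp measurable_prodMk_left).coe_nnreal_real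
  -- measurable surrogates of `GF_k`, `A_k` (extended by `0` off `D`)
  have hGF' : Measurable (D.piecewise (gfOfRecord F N K k) 0) := hGF.measurable_piecewise continuousOn_const hDm
  have hA' : Measurable (D.piecewise (effActionHT F N T (chiFixed29 F N ν ε₁) K g k) 0) := hA.measurable_piecewise continuousOn_const hDm
  have hχ := measurable_chiFix29OfRecord_comp_chart (F := F) (N := N) ν ε₁ hΦ havgΦ
  have hF : Measurable fun z => (J (V, z) : ℝ) * (chiFix29OfRecord F N ν ε₁ K k (Φ (V, z)) *
      Real.exp (-(1 / (g k) ^ 2) * D.piecewise (gfOfRecord F N K k) 0 (Φ (V, z)) +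
        D.piecewise (effActionHT F N T (chiFixed29 F N ν ε₁) K g k) 0 (Φ (V, z)))) :=
    hJV.mul (hχ.mul (Real.measurable_exp.comp (((measurable_const.mul (hGF'.comp hΦV)).add (hA'.comp hΦV)))))
  refine hF.aestronglyMeasurable.congr ?_
  filter_upwards [hdom] with z hz
  rw [betaInput_chi29_apply, Set.piecewise_eq_of_mem _ _ _ hz, Set.piecewise_eq_of_mem _ _ _ hz]

/-- **★★ THE DOORS' `hmeas` FROM FILE 2's CONFINEMENT DATUM**: with `hconf` (per `V₀ ∈ U`: a compact `C ⊆ D` and, for `V` near `V₀` within `U`, `Φ(V,z) ∈ C` a.e.), `Ū∘Φ = ` the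
coarse field on `U`, and `GF_k`, `A_k` continuous on the measurable `D`: `∀ V₀ ∈ U, ∀ᶠ V in 𝓝[U] V₀, AEStronglyMeasurable (fibre integrand at V) τ`.
[cite: Balaban1987RG1, (2.10) p.267 (bookkeeping)] -/
theorem hmeas_of_confined (ν : Stage7Numerics) (ε₁ : ℝ) (T : Transport F N) (K : ℕ) (g : ℕ → ℝ) (k : ℕ)
    {τ : Measure Z} {Φ : (PBond (F.P K) (k + 1) → SU N) × Z → GaugeField (F.P K) k (SU N)} {J : (PBond (F.P K) (k + 1) → SU N) × Z → ℝ≥0}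
    (hΦ : Measurable Φ) (hJ : Measurable J) {U : Set (PBond (F.P K) (k + 1) → SU N)} {D : Set (GaugeField (F.P K) k (SU N))} (hDm : MeasurableSet D)
    (hGF : ContinuousOn (gfOfRecord F N K k) D) (hA : ContinuousOn (effActionHT F N T (chiFixed29 F N ν ε₁) K g k) D)
    (havgΦ : ∀ V ∈ U, ∀ z, (avOfRecord F N K k).avg (Φ (V, z)) = V)
    (hconf : ∀ V₀ ∈ U, ∃ C ⊆ D, IsCompact C ∧ ∃ bound : Z → ℝ, Integrable bound τ ∧
      ∀ᶠ V in 𝓝[U] V₀, ∀ᵐ z ∂τ, (J (V, z) : ℝ) ≤ bound z ∧ Φ (V, z) ∈ C) :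
    ∀ V₀ ∈ U, ∀ᶠ V in 𝓝[U] V₀,
      AEStronglyMeasurable (fun z => (J (V, z) : ℝ) * betaInputOfRecord F N T (chiFixed29 F N ν ε₁) K g k (Φ (V, z))) τ := by
  intro V₀ hV₀
  obtain ⟨C, hCD, -, bound, -, hev⟩ := hconf V₀ hV₀
  filter_upwards [hev, eventually_mem_nhdsWithin] with V hV hVU
  exact aestronglyMeasurable_fibreIntegrand_of_confined ν ε₁ T K g k hΦ hJ hDm hGF hA (havgΦ V hVU)
    (by filter_upwards [hV] with z hz using hCD hz.2)

/-- **★★ THE DEVIATIONS' CONTINUITY `hφ` FROM ONE N07-SHAPED HYPOTHESIS**: if the critical configuration `V ↦ V^{(k)}(V)` is continuous on `U` (N07's [B11] Thm 1 for a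
continuous selector of minimisers — DISPLAYED) and `V ↦ Φ(V,z)` is continuous at `V₀` within `U` for a.e. `z`, then every deviation `V ↦ fluctDev_k(Φ(V,z))(b)` is
continuous at `V₀` within `U` for a.e. `z` (along the chart the deviation reads `dist1(V^{(k)}(V)(b)⁻¹·Φ(V,z)(b))`, `Ū(Φ(V,z)) = V`).
[cite: Balaban1987RG1, (2.3) p.265, (2.9) p.266 and (2.10) p.267 (bookkeeping)] -/
theorem hφ_of_continuousOn_critCfg (ν : Stage7Numerics) {K k : ℕ} {τ : Measure Z}
    {Φ : (PBond (F.P K) (k + 1) → SU N) × Z → GaugeField (F.P K) k (SU N)} {U : Set (PBond (F.P K) (k + 1) → SU N)}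
    (havgΦ : ∀ V ∈ U, ∀ z, (avOfRecord F N K k).avg (Φ (V, z)) = V) (hcrit : ContinuousOn (critCfgOfRecord F N ν K k) U)
    (hΦV : ∀ V₀ ∈ U, ∀ᵐ z ∂τ, ContinuousWithinAt (fun V => Φ (V, z)) U V₀) :
    ∀ V₀ ∈ U, ∀ b : PBond (F.P K) k, ¬ IsB0 b → ∀ᵐ z ∂τ, ContinuousWithinAt (fun V => fluctDevOfRecord F N ν K k (Φ (V, z)) b) U V₀ := by
  intro V₀ hV₀ b _
  filter_upwards [hΦV V₀ hV₀] with z hz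
  have hc : ContinuousWithinAt (fun V => dist1 ((critCfgOfRecord F N ν K k V b)⁻¹ * Φ (V, z) b)) U V₀ :=
    continuous_dist1_SU.continuousAt.comp_continuousWithinAt
      ((((continuous_apply b).continuousAt.comp_continuousWithinAt (hcrit V₀ hV₀)).inv).mul
        ((continuous_apply b).continuousAt.comp_continuousWithinAt hz))
  exact hc.congr (fun V hV => fluctDevOfRecord_eq_of_avg_eq ν (havgΦ V hV z) b) (fluctDevOfRecord_eq_of_avg_eq ν (havgΦ V₀ hV₀ z) b)

end Hmeas

/-! ## §2 The tower on geometric chart data: `hmeas` and `hGF` supplied inside the induction -/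

section Tower

variable (ν : Stage7Numerics) {ε₁ : ℝ} (K : ℕ) (g : ℕ → ℝ)
  {Z : ℕ → Type*} [∀ j, TopologicalSpace (Z j)] [∀ j, MeasurableSpace (Z j)] (τ : ∀ j, Measure (Z j)) [∀ j, SFinite (τ j)] [∀ j, (τ j).IsOpenPosMeasure]
  (Φ : ∀ j, (PBond (F.P K) (j + 1) → SU N) × Z j → GaugeField (F.P K) j (SU N))
  (J : ∀ j, (PBond (F.P K) (j + 1) → SU N) × Z j → ℝ≥0)
  (z₀ : ∀ j, (PBond (F.P K) (j + 1) → SU N) → Z j)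

/-- **★★★ THE (F1) TOWER ON GEOMETRIC CHART DATA**: `A_j` is continuous on `domAlt_j` for every `j ≤ K`, by induction on `j`, from — per step `j < K` — dag-n09-w6 g2's sockets
`hΦ hJ havgΦ hmap` over `domAlt_{j+1}` on `{χ^{(2.9)}_j ≠ 0}`, print's base point (`hz₀ hΦc hJpos`), the A-FREE regularity `hconf hΦV hJV hφ hnull`; [B11] solvability
`hsolν`; (I19) `hint`; and the numerics `0 < ε₁`, `0 ≤ ν.ε₀`, `((d·L)²∕4)·ν.ε₀ < δ_N` — `hmeas` being supplied by §1 from the induction hypothesis and `hGF` by FILE 4.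
Nothing of Bałaban's asserted. [cite: Balaban1987RG1, (0.17)–(0.19) p.255, p.259, (0.11) p.253, (2.9) p.266 and (2.10) p.267] -/
theorem continuousOn_effActionHT_all_of_geometricChartData (hε : 0 < ε₁) (hε₀ : 0 ≤ ν.ε₀)
    (hnumF : ((((F.P K).d * (F.P K).L : ℕ) : ℝ)) ^ 2 / 4 * ν.ε₀ < deltaFed (Fin N))
    (hsolν : ∀ j < K, ∀ W ∈ domAltOfRecord F N ν K (j + 1), UkExists F N K (j + 1) ν.εreg W)
    (hint : ∀ j < K, Integrable (betaInputOfRecord F N (TcanOfRecord F N) (chiFixed29 F N ν ε₁) K g j) (fieldMeasure (F.P K) j (SU N)))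
    (hΦ : ∀ j, Measurable (Φ j)) (hJ : ∀ j, Measurable (J j))
    (havgΦ : ∀ j < K, ∀ V ∈ domAltOfRecord F N ν K (j + 1), ∀ z, (avOfRecord F N K j).avg (Φ j (V, z)) = V)
    (hmap : ∀ j < K, (fieldMeasure (F.P K) j (SU N)).restrict ((avOfRecord F N K j).avg ⁻¹' domAltOfRecord F N ν K (j + 1) ∩
        {U | chiFixed29 F N ν ε₁ K g j U ≠ 0})
      = ((((piHaar (F.P K) (j + 1) (SU N)).restrict (domAltOfRecord F N ν K (j + 1))).prod (τ j)).withDensity (fun p => (J j p : ℝ≥0∞))).map (Φ j))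
    (hconf : ∀ j < K, ∀ V₀ ∈ domAltOfRecord F N ν K (j + 1), ∃ C ⊆ domAltOfRecord F N ν K j, IsCompact C ∧ ∃ bound : Z j → ℝ, Integrable bound (τ j) ∧
      ∀ᶠ V in 𝓝[domAltOfRecord F N ν K (j + 1)] V₀, ∀ᵐ z ∂(τ j), (J j (V, z) : ℝ) ≤ bound z ∧ Φ j (V, z) ∈ C)
    (hΦV : ∀ j < K, ∀ V₀ ∈ domAltOfRecord F N ν K (j + 1), ∀ᵐ z ∂(τ j), ContinuousWithinAt (fun V => Φ j (V, z)) (domAltOfRecord F N ν K (j + 1)) V₀)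
    (hJV : ∀ j < K, ∀ V₀ ∈ domAltOfRecord F N ν K (j + 1), ∀ᵐ z ∂(τ j), ContinuousWithinAt (fun V => (J j (V, z) : ℝ)) (domAltOfRecord F N ν K (j + 1)) V₀)
    (hcrit : ∀ j < K, ContinuousOn (critCfgOfRecord F N ν K j) (domAltOfRecord F N ν K (j + 1)))
    (hnull : ∀ j < K, ∀ V₀ ∈ domAltOfRecord F N ν K (j + 1), ∀ b : PBond (F.P K) j, ¬ IsB0 b →
      τ j {z | fluctDevOfRecord F N ν K j (Φ j (V₀, z)) b = ε₁} = 0)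
    (hz₀ : ∀ j < K, ∀ V ∈ domAltOfRecord F N ν K (j + 1), Φ j (V, z₀ j V) = critCfgOfRecord F N ν K j V)
    (hΦc : ∀ j < K, ∀ V ∈ domAltOfRecord F N ν K (j + 1), ContinuousAt (fun z => Φ j (V, z)) (z₀ j V))
    (hJpos : ∀ j < K, ∀ V ∈ domAltOfRecord F N ν K (j + 1), ∀ᶠ z in 𝓝 (z₀ j V), 0 < J j (V, z)) :
    ∀ j, j ≤ K → ContinuousOn (effActionHT F N (TcanOfRecord F N) (chiFixed29 F N ν ε₁) K g j) (domAltOfRecord F N ν K j)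
  | 0, _ => continuousOn_effActionHT_zero _ _ K g _
  | j + 1, hj => by
    have hjK : j < K := Nat.lt_of_succ_le hj
    have ih := continuousOn_effActionHT_all_of_geometricChartData hε hε₀ hnumF hsolν hint hΦ hJ havgΦ hmap hconf hΦV hJV hcrit hnull hz₀ hΦc hJpos j hjK.le
    have hGF : ContinuousOn (gfOfRecord F N K j) (domAltOfRecord F N ν K j) :=
      continuousOn_gfOfRecord_domAlt ν (succ_le_range_of_lt (F := F) hjK) hε₀ hnumF
    have hmeas := hmeas_of_confined ν ε₁ (TcanOfRecord F N) K g j (hΦ j) (hJ j) (measurableSet_domAltOfRecord ν K j) hGF ih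
      (havgΦ j hjK) (hconf j hjK)
    exact continuousOn_effActionHT_succ_of_chartRegularity ν hε K g hjK (hsolν j hjK) (hint j hjK) hGF ih (τ j)
      {U | chiFixed29 F N ν ε₁ K g j U ≠ 0} (fun U hU => mem_setOf_chi_ne_zero_of_betaInputOfRecord_ne_zero _ _ _ _ _ U hU) (Φ j) (J j) (hΦ j) (hJ j)
      (havgΦ j hjK) (hmap j hjK) hmeas (hconf j hjK) (hΦV j hjK) (hJV j hjK)
      (hφ_of_continuousOn_critCfg ν (havgΦ j hjK) (hcrit j hjK) (hΦV j hjK)) (hnull j hjK) (z₀ j) (hz₀ j hjK) (hΦc j hjK) (hJpos j hjK)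

/-- **★★★ … HENCE `hreg_j` AND (F3)_j FOR EVERY `j < K` ON GEOMETRIC CHART DATA** (FILE 2's `hreg_pos_contA_of_chartRegularity` at step `j`, fed with the tower's `A_j`, §1's `hmeas`
and FILE 4's `hGF`). [cite: Balaban1987RG1, p.259, (0.19) p.255 and (2.10) p.267] -/
theorem hreg_pos_all_of_geometricChartData (hε : 0 < ε₁) (hε₀ : 0 ≤ ν.ε₀)
    (hnumF : ((((F.P K).d * (F.P K).L : ℕ) : ℝ)) ^ 2 / 4 * ν.ε₀ < deltaFed (Fin N))
    (hsolν : ∀ j < K, ∀ W ∈ domAltOfRecord F N ν K (j + 1), UkExists F N K (j + 1) ν.εreg W)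
    (hint : ∀ j < K, Integrable (betaInputOfRecord F N (TcanOfRecord F N) (chiFixed29 F N ν ε₁) K g j) (fieldMeasure (F.P K) j (SU N)))
    (hΦ : ∀ j, Measurable (Φ j)) (hJ : ∀ j, Measurable (J j))
    (havgΦ : ∀ j < K, ∀ V ∈ domAltOfRecord F N ν K (j + 1), ∀ z, (avOfRecord F N K j).avg (Φ j (V, z)) = V)
    (hmap : ∀ j < K, (fieldMeasure (F.P K) j (SU N)).restrict ((avOfRecord F N K j).avg ⁻¹' domAltOfRecord F N ν K (j + 1) ∩
        {U | chiFixed29 F N ν ε₁ K g j U ≠ 0})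
      = ((((piHaar (F.P K) (j + 1) (SU N)).restrict (domAltOfRecord F N ν K (j + 1))).prod (τ j)).withDensity (fun p => (J j p : ℝ≥0∞))).map (Φ j))
    (hconf : ∀ j < K, ∀ V₀ ∈ domAltOfRecord F N ν K (j + 1), ∃ C ⊆ domAltOfRecord F N ν K j, IsCompact C ∧ ∃ bound : Z j → ℝ, Integrable bound (τ j) ∧
      ∀ᶠ V in 𝓝[domAltOfRecord F N ν K (j + 1)] V₀, ∀ᵐ z ∂(τ j), (J j (V, z) : ℝ) ≤ bound z ∧ Φ j (V, z) ∈ C)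
    (hΦV : ∀ j < K, ∀ V₀ ∈ domAltOfRecord F N ν K (j + 1), ∀ᵐ z ∂(τ j), ContinuousWithinAt (fun V => Φ j (V, z)) (domAltOfRecord F N ν K (j + 1)) V₀)
    (hJV : ∀ j < K, ∀ V₀ ∈ domAltOfRecord F N ν K (j + 1), ∀ᵐ z ∂(τ j), ContinuousWithinAt (fun V => (J j (V, z) : ℝ)) (domAltOfRecord F N ν K (j + 1)) V₀)
    (hcrit : ∀ j < K, ContinuousOn (critCfgOfRecord F N ν K j) (domAltOfRecord F N ν K (j + 1)))
    (hnull : ∀ j < K, ∀ V₀ ∈ domAltOfRecord F N ν K (j + 1), ∀ b : PBond (F.P K) j, ¬ IsB0 b →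
      τ j {z | fluctDevOfRecord F N ν K j (Φ j (V₀, z)) b = ε₁} = 0)
    (hz₀ : ∀ j < K, ∀ V ∈ domAltOfRecord F N ν K (j + 1), Φ j (V, z₀ j V) = critCfgOfRecord F N ν K j V)
    (hΦc : ∀ j < K, ∀ V ∈ domAltOfRecord F N ν K (j + 1), ContinuousAt (fun z => Φ j (V, z)) (z₀ j V))
    (hJpos : ∀ j < K, ∀ V ∈ domAltOfRecord F N ν K (j + 1), ∀ᶠ z in 𝓝 (z₀ j V), 0 < J j (V, z)) :
    ∀ j < K, domAltOfRecord F N ν K (j + 1) ⊆ regSetOfRecord F N K j (betaInputOfRecord F N (TcanOfRecord F N) (chiFixed29 F N ν ε₁) K g j) ∧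
      ∀ V ∈ domAltOfRecord F N ν K (j + 1), 0 < TcanOfRecord F N K j (betaInputOfRecord F N (TcanOfRecord F N) (chiFixed29 F N ν ε₁) K g j) V := by
  intro j hjK
  have ih := continuousOn_effActionHT_all_of_geometricChartData ν K g τ Φ J z₀ hε hε₀ hnumF hsolν hint hΦ hJ havgΦ hmap hconf hΦV hJV hcrit hnull hz₀ hΦc hJpos
    j hjK.le
  have hGF : ContinuousOn (gfOfRecord F N K j) (domAltOfRecord F N ν K j) :=
    continuousOn_gfOfRecord_domAlt ν (succ_le_range_of_lt (F := F) hjK) hε₀ hnumF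
  have hmeas := hmeas_of_confined ν ε₁ (TcanOfRecord F N) K g j (hΦ j) (hJ j) (measurableSet_domAltOfRecord ν K j) hGF ih
    (havgΦ j hjK) (hconf j hjK)
  have h := hreg_pos_contA_of_chartRegularity ν hε K g hjK (hsolν j hjK) (hint j hjK) hGF ih (τ j)
    {U | chiFixed29 F N ν ε₁ K g j U ≠ 0} (fun U hU => mem_setOf_chi_ne_zero_of_betaInputOfRecord_ne_zero _ _ _ _ _ U hU) (Φ j) (J j) (hΦ j) (hJ j)
    (havgΦ j hjK) (hmap j hjK) hmeas (hconf j hjK) (hΦV j hjK) (hJV j hjK)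
      (hφ_of_continuousOn_critCfg ν (havgΦ j hjK) (hcrit j hjK) (hΦV j hjK)) (hnull j hjK) (z₀ j) (hz₀ j hjK) (hΦc j hjK) (hJpos j hjK)
  exact ⟨h.1, h.2.1⟩

end Tower

/-! ## §3 At the Stage-13 record: `hreg` and dag-n09-w4 g3's door on geometric chart data -/

section Record

variable (θ : Stage13HParams F N) (h : θ.Provisos₁₃SepCoPH F N) {w : WorldP} (P : B12.RunParams)
  {Z : ℕ → Type*} [∀ j, TopologicalSpace (Z j)] [∀ j, MeasurableSpace (Z j)] (τ : ∀ j, Measure (Z j)) [∀ j, SFinite (τ j)] [∀ j, (τ j).IsOpenPosMeasure]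
  (Φ : ∀ j, (PBond (F.P P.K) (j + 1) → SU N) × Z j → GaugeField (F.P P.K) j (SU N))
  (J : ∀ j, (PBond (F.P P.K) (j + 1) → SU N) × Z j → ℝ≥0)
  (z₀ : ∀ j, (PBond (F.P P.K) (j + 1) → SU N) → Z j)

/-- **★★ THE DOORS' ANALYTIC INCLUSION `hreg` AT THE STAGE-13 RECORD ON GEOMETRIC CHART DATA** (`TβOfRecord₁₃ = TcanOfRecord`, `chiβOfRecord₁₃ θ = chiFixed29 θ.ν θ.ε₂₉`).
[cite: Balaban1987RG1, p.259, (2.10) p.267 and (0.13) p.254] -/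
theorem hreg_of_geometricChartData (hε : 0 < θ.ε₂₉) (hε₀ : 0 ≤ θ.toStage13Params.ν.ε₀)
    (hnumF : ((((F.P P.K).d * (F.P P.K).L : ℕ) : ℝ)) ^ 2 / 4 * θ.toStage13Params.ν.ε₀ < deltaFed (Fin N))
    (hsolν : ∀ j < P.K, ∀ W ∈ domAltOfRecord F N θ.ν P.K (j + 1), UkExists F N P.K (j + 1) θ.toStage13Params.ν.εreg W)
    (hint : ∀ j < P.K, Integrable (betaInputOfRecord F N (TβOfRecord₁₃ F N) (chiβOfRecord₁₃ F N θ.toStage13Params) P.K (gOfRecord₁₃ F N θ.toStage13Params P) j)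
      (fieldMeasure (F.P P.K) j (SU N)))
    (hΦ : ∀ j, Measurable (Φ j)) (hJ : ∀ j, Measurable (J j))
    (havgΦ : ∀ j < P.K, ∀ V ∈ domAltOfRecord F N θ.ν P.K (j + 1), ∀ z, (avOfRecord F N P.K j).avg (Φ j (V, z)) = V)
    (hmap : ∀ j < P.K, (fieldMeasure (F.P P.K) j (SU N)).restrict ((avOfRecord F N P.K j).avg ⁻¹' domAltOfRecord F N θ.ν P.K (j + 1) ∩
        {U | chiβOfRecord₁₃ F N θ.toStage13Params P.K (gOfRecord₁₃ F N θ.toStage13Params P) j U ≠ 0})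
      = ((((piHaar (F.P P.K) (j + 1) (SU N)).restrict (domAltOfRecord F N θ.ν P.K (j + 1))).prod (τ j)).withDensity
          (fun p => (J j p : ℝ≥0∞))).map (Φ j))
    (hconf : ∀ j < P.K, ∀ V₀ ∈ domAltOfRecord F N θ.ν P.K (j + 1), ∃ C ⊆ domAltOfRecord F N θ.ν P.K j, IsCompact C ∧ ∃ bound : Z j → ℝ, Integrable bound (τ j) ∧
      ∀ᶠ V in 𝓝[domAltOfRecord F N θ.ν P.K (j + 1)] V₀, ∀ᵐ z ∂(τ j), (J j (V, z) : ℝ) ≤ bound z ∧ Φ j (V, z) ∈ C)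
    (hΦV : ∀ j < P.K, ∀ V₀ ∈ domAltOfRecord F N θ.ν P.K (j + 1), ∀ᵐ z ∂(τ j),
      ContinuousWithinAt (fun V => Φ j (V, z)) (domAltOfRecord F N θ.ν P.K (j + 1)) V₀)
    (hJV : ∀ j < P.K, ∀ V₀ ∈ domAltOfRecord F N θ.ν P.K (j + 1), ∀ᵐ z ∂(τ j),
      ContinuousWithinAt (fun V => (J j (V, z) : ℝ)) (domAltOfRecord F N θ.ν P.K (j + 1)) V₀)
    (hcrit : ∀ j < P.K, ContinuousOn (critCfgOfRecord F N θ.toStage13Params.ν P.K j) (domAltOfRecord F N θ.ν P.K (j + 1)))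
    (hnull : ∀ j < P.K, ∀ V₀ ∈ domAltOfRecord F N θ.ν P.K (j + 1), ∀ b : PBond (F.P P.K) j, ¬ IsB0 b →
      τ j {z | fluctDevOfRecord F N θ.toStage13Params.ν P.K j (Φ j (V₀, z)) b = θ.toStage13Params.ε₂₉} = 0)
    (hz₀ : ∀ j < P.K, ∀ V ∈ domAltOfRecord F N θ.ν P.K (j + 1), Φ j (V, z₀ j V) = critCfgOfRecord F N θ.toStage13Params.ν P.K j V)
    (hΦc : ∀ j < P.K, ∀ V ∈ domAltOfRecord F N θ.ν P.K (j + 1), ContinuousAt (fun z => Φ j (V, z)) (z₀ j V))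
    (hJpos : ∀ j < P.K, ∀ V ∈ domAltOfRecord F N θ.ν P.K (j + 1), ∀ᶠ z in 𝓝 (z₀ j V), 0 < J j (V, z)) :
    ∀ j < P.K, domAltOfRecord F N θ.ν P.K (j + 1) ⊆ regSetOfRecord F N P.K j
      (betaInputOfRecord F N (TβOfRecord₁₃ F N) (chiβOfRecord₁₃ F N θ.toStage13Params) P.K (gOfRecord₁₃ F N θ.toStage13Params P) j) :=
  fun j hj => (hreg_pos_all_of_geometricChartData θ.toStage13Params.ν P.K (gOfRecord₁₃ F N θ.toStage13Params P) τ Φ J z₀ hε hε₀ hnumF hsolν hint hΦ hJ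
    havgΦ hmap hconf hΦV hJV hcrit hnull hz₀ hΦc hJpos j hj).1

/-- **★★★ N09's THEOREM-3 MEMBER AT THE STAGE-13 RECORD ON GEOMETRIC CHART DATA** (dag-n09-w4 g3's `…N09B0RiderAtRecord.thm3Member_stage13SepCoPH_atDomAlt_of_numerics_of_εreg_eq`
with `hreg := hreg_of_geometricChartData …`): N09-side inputs = (181)ˢᵒˡ `hcov`, `hsolν` + [B11] ×3 at one radius (N07), (I19) `hint`, NUMERICS (now including `0 ≤ ν.ε₀` and
Federbush's `((d·L)²∕4)·ν.ε₀ < δ_N`), and per step `j < P.K` a fibred chart of the averaging of record over `domAlt_{j+1}` on `{χ^{(2.9)}_j ≠ 0}` through the critical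
configuration with A-FREE regularity — NO `hreg`, NO `hgc`, NO `hmeas`, NO `hGF`.  CONDITIONAL; nothing of Bałaban's asserted; N09 NOT discharged.
[cite: Balaban1987RG1, Thm 3 p.264, p.259, (0.11) p.253, (0.17)–(0.19) p.255, (2.9) p.266, (2.10) p.267; Balaban1985Variational, Thm 1 (8)–(10) p.279 and (181) p.307] -/
theorem thm3Member_stage13SepCoPH_atDomAlt_of_geometricChartData_of_numerics_of_εreg_eq
    (hC : w.C = (datumOfRecord₁₃SepCoPH F N θ h).C) (hε : 0 < θ.ε₂₉) (heq : θ.toStage13Params.ν.εreg = θ.εbg)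
    (hεreg : 0 < θ.toStage13Params.ν.εreg) (hε₀ : 0 ≤ θ.toStage13Params.ν.ε₀)
    (hnumF : ((((F.P P.K).d * (F.P P.K).L : ℕ) : ℝ)) ^ 2 / 4 * θ.toStage13Params.ν.ε₀ < deltaFed (Fin N))
    (hε3 : (143 * (((((F.P P.K).d + 4 : ℕ) : ℝ)) ^ 2 / 4) ^ 2) * θ.toStage13Params.ν.εreg ≤ 1 / 3)
    (hε2 : 2 * θ.toStage13Params.ν.εreg ≤ 2 * deltaSU (Fin N) / ((((F.P P.K).d + 4) * (F.P P.K).L : ℕ) : ℝ) ^ 2)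
    (hord : 2 * θ.toStage13Params.ν.εreg / ((F.P P.K).L : ℝ) ^ 2 +
      4 * max θ.toStage13Params.ε₂₉ (10 * (((((F.P P.K).d + 2) * (F.P P.K).L : ℕ) : ℝ) * θ.toStage13Params.ε₂₉) * ((F.P P.K).L : ℝ) ^ ((F.P P.K).d - 1)) ≤
        θ.toStage13Params.ν.ε₀)
    (hn1 : 1640 * (2 * (((((F.P P.K).d + 2) * (F.P P.K).L : ℕ) : ℝ) * θ.toStage13Params.ε₂₉) +
        ((((F.P P.K).d + 2) * (F.P P.K).L : ℕ) : ℝ) ^ 2 / 4 * (2 * θ.toStage13Params.ν.εreg / ((F.P P.K).L : ℝ) ^ 2)) *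
          (((F.P P.K).L : ℝ) ^ ((F.P P.K).d - 1)) ^ 2 ≤ 1)
    (hn2 : 13 * (2 * (((((F.P P.K).d + 2) * (F.P P.K).L : ℕ) : ℝ) * θ.toStage13Params.ε₂₉) +
        ((((F.P P.K).d + 2) * (F.P P.K).L : ℕ) : ℝ) ^ 2 / 4 * (2 * θ.toStage13Params.ν.εreg / ((F.P P.K).L : ℝ) ^ 2)) *
          ((F.P P.K).L : ℝ) ^ ((F.P P.K).d - 1) < deltaSU (Fin N))
    (hcov : ∀ j < P.K, ∀ (v : GaugeTransf (F.P P.K) (j + 1) (SU N)) (W : GaugeField (F.P P.K) (j + 1) (SU N)),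
      UkExists F N P.K (j + 1) θ.toStage13Params.ν.εreg W →
        critCfgOfRecord F N θ.toStage13Params.ν P.K j (gaugeAct v W) = gaugeAct (liftTransf v) (critCfgOfRecord F N θ.toStage13Params.ν P.K j W))
    (hsolν : ∀ j < P.K, ∀ W ∈ domAltOfRecord F N θ.ν P.K (j + 1), UkExists F N P.K (j + 1) θ.toStage13Params.ν.εreg W)
    (hint : ∀ j < P.K, Integrable (betaInputOfRecord F N (TβOfRecord₁₃ F N) (chiβOfRecord₁₃ F N θ.toStage13Params) P.K (gOfRecord₁₃ F N θ.toStage13Params P) j)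
      (fieldMeasure (F.P P.K) j (SU N)))
    (hΦ : ∀ j, Measurable (Φ j)) (hJ : ∀ j, Measurable (J j))
    (havgΦ : ∀ j < P.K, ∀ V ∈ domAltOfRecord F N θ.ν P.K (j + 1), ∀ z, (avOfRecord F N P.K j).avg (Φ j (V, z)) = V)
    (hmap : ∀ j < P.K, (fieldMeasure (F.P P.K) j (SU N)).restrict ((avOfRecord F N P.K j).avg ⁻¹' domAltOfRecord F N θ.ν P.K (j + 1) ∩
        {U | chiβOfRecord₁₃ F N θ.toStage13Params P.K (gOfRecord₁₃ F N θ.toStage13Params P) j U ≠ 0})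
      = ((((piHaar (F.P P.K) (j + 1) (SU N)).restrict (domAltOfRecord F N θ.ν P.K (j + 1))).prod (τ j)).withDensity
          (fun p => (J j p : ℝ≥0∞))).map (Φ j))
    (hconf : ∀ j < P.K, ∀ V₀ ∈ domAltOfRecord F N θ.ν P.K (j + 1), ∃ C ⊆ domAltOfRecord F N θ.ν P.K j, IsCompact C ∧ ∃ bound : Z j → ℝ, Integrable bound (τ j) ∧
      ∀ᶠ V in 𝓝[domAltOfRecord F N θ.ν P.K (j + 1)] V₀, ∀ᵐ z ∂(τ j), (J j (V, z) : ℝ) ≤ bound z ∧ Φ j (V, z) ∈ C)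
    (hΦV : ∀ j < P.K, ∀ V₀ ∈ domAltOfRecord F N θ.ν P.K (j + 1), ∀ᵐ z ∂(τ j),
      ContinuousWithinAt (fun V => Φ j (V, z)) (domAltOfRecord F N θ.ν P.K (j + 1)) V₀)
    (hJV : ∀ j < P.K, ∀ V₀ ∈ domAltOfRecord F N θ.ν P.K (j + 1), ∀ᵐ z ∂(τ j),
      ContinuousWithinAt (fun V => (J j (V, z) : ℝ)) (domAltOfRecord F N θ.ν P.K (j + 1)) V₀)
    (hcrit : ∀ j < P.K, ContinuousOn (critCfgOfRecord F N θ.toStage13Params.ν P.K j) (domAltOfRecord F N θ.ν P.K (j + 1)))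
    (hnull : ∀ j < P.K, ∀ V₀ ∈ domAltOfRecord F N θ.ν P.K (j + 1), ∀ b : PBond (F.P P.K) j, ¬ IsB0 b →
      τ j {z | fluctDevOfRecord F N θ.toStage13Params.ν P.K j (Φ j (V₀, z)) b = θ.toStage13Params.ε₂₉} = 0)
    (hz₀ : ∀ j < P.K, ∀ V ∈ domAltOfRecord F N θ.ν P.K (j + 1), Φ j (V, z₀ j V) = critCfgOfRecord F N θ.toStage13Params.ν P.K j V)
    (hΦc : ∀ j < P.K, ∀ V ∈ domAltOfRecord F N θ.ν P.K (j + 1), ContinuousAt (fun z => Φ j (V, z)) (z₀ j V))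
    (hJpos : ∀ j < P.K, ∀ V ∈ domAltOfRecord F N θ.ν P.K (j + 1), ∀ᶠ z in 𝓝 (z₀ j V), 0 < J j (V, z))
    (h11 : ∀ k, k ≤ P.K → ∀ V ∈ domAltOfRecord F N θ.ν P.K k, UkExists F N P.K k θ.εbg V ∧ UniqueUkOrbit F N P.K k θ.εbg V)
    (hres : ∀ k, k ≤ P.K → HRestrict F N θ.εbg P.K k (domAltOfRecord F N θ.ν P.K k))
    (huniq : ∀ k, k ≤ P.K → ∀ V ∈ domAltOfRecord F N θ.ν P.K k, ∀ j < k,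
      UniqueUkOrbit F N P.K (j + 1) θ.εbg (Averaging.iter (avOfRecord F N P.K) (j + 1) (Uk F N P.K k θ.εbg V))) :
    (leavesP w P).smallCouplings → (leavesP w P).smallFieldInductive :=
  thm3Member_stage13SepCoPH_atDomAlt_of_numerics_of_εreg_eq θ h hC P hε heq hεreg hε3 hε2 hord hn1 hn2 hcov hsolν hint
    (hreg_of_geometricChartData θ P τ Φ J z₀ hε hε₀ hnumF hsolν hint hΦ hJ havgΦ hmap hconf hΦV hJV hcrit hnull hz₀ hΦc hJpos)
    h11 hres huniq

end Record

end Summit.QuantumFields.YangMills.BalabanUVNodes.N09RegularityTowerOfGeometricChartData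

end
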